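import Summits.HodgeConjecture.HodgeConjecture.Theses.HeckePrymWeil

/-!
# Sketch — crux-ideate round 1, ideator k = 2, crux `HeckePrymWeil.WeilTenfoldsSqrtMinus11`
(item stmt-HodgeConjecture-1262).  First lemmas of the two idea cards, stated over existing
declarations only; proofs are not required at this stage (`sorry` where non-trivial).

* Card `odd-norm-cm-enlargement`: `LAnchorWeilLefschetz` (the anchors' Weil classes are
  Lefschetz) and `lAnchorWeilLefschetz_of_crux` (it is a literal special case of the crux).
* Card `balanced-undecic-pencil`: `gaussSum_sq` (a μ₁₁-action with vanishing norm gives the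
  crux's endomorphism `φ ≫ φ = -11`) and `CyclotomicTenfoldCase` / `cyclotomicTenfoldCase_of_crux`.
-/

noncomputable section

open CategoryTheory

namespace Summit.HodgeConjecture.HodgeConjecture.Cruxes.WeilTenfoldsSqrtMinus11.IdeatorTwo

open Literature.AlgebraicGeometry Literature.AlgebraicGeometry.HodgeTheory

/-- The crux, by name. -/
abbrev Crux : Prop := Summit.HodgeConjecture.HodgeConjecture.Theses.HeckePrymWeil.WeilTenfoldsSqrtMinus11

variable (A : Motives.AbelianVariety ℂ)

/-- The complexified Weil plane of `(A, φ)` in degree 10, typed exactly as in the crux: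
`Eig((𝟙+φ)^*, (1+i√11)^10) ⊔ Eig((𝟙+φ)^*, (1-i√11)^10)`. -/
def weilPlane (φ : A ⟶ A) : Submodule ℂ (complexBetti A.X 10) :=
  Module.End.eigenspace (complexBetti.map (𝟙 A + φ).hom.hom.hom 10).hom
      ((1 + Complex.I * (Real.sqrt (11 : ℝ) : ℂ)) ^ 10) ⊔
    Module.End.eigenspace (complexBetti.map (𝟙 A + φ).hom.hom.hom 10).hom
      ((1 - Complex.I * (Real.sqrt (11 : ℝ) : ℂ)) ^ 10)

/-- A primitive 11-th root of unity in `ℂ`. -/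
def ζ₁₁ : ℂ := Complex.exp (2 * Real.pi * Complex.I / 11)

/-- The `k`-th CYCLOTOMIC DIVISOR LINE of `(A, ζ)`: the classes `b ∈ H²(A(ℂ); ℂ)` with
`ζ^* b = ζ₁₁^{2k} b` and `(𝟙 + ζ)^* b = (1 + ζ₁₁^k)² b`.  When `ζ` generates an action of
`ℤ[ζ₁₁]` on the abelian TENFOLD `A` (so `H¹ = ⊕ₖ Vₖ`, `dim Vₖ = 2`), this is exactly `⋀² Vₖ`
(the two eigenvalue conditions single out `a = b = k` among `V_a ⊗ V_b`, `a + b ≡ 2k`, because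
`|ζ₁₁^a + ζ₁₁^b| = 2` forces `a = b`); the ten lines `⋀² Vₖ` span `(⋀²_L H¹) ⊗ ℂ`,
`L = ℚ(ζ₁₁)`. -/
def cycloDivisorLine (ζ : A ⟶ A) (k : ℕ) : Submodule ℂ (complexBetti A.X 2) :=
  Module.End.eigenspace (complexBetti.map ζ.hom.hom.hom 2).hom (ζ₁₁ ^ (2 * k)) ⊓
    Module.End.eigenspace (complexBetti.map (𝟙 A + ζ).hom.hom.hom 2).hom ((1 + ζ₁₁ ^ k) ^ 2)

/-- The quadratic GAUSS SUM in an order-11 endomorphism: `g(ζ) = Σ_{k=1}^{10} (k/11) ζ^k`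
(squares mod 11 = {1,3,4,5,9}).  Written in the ring `End A` (multiplication = composition). -/
def gaussSum (z : CategoryTheory.End A) : CategoryTheory.End A :=
  z + z ^ 3 + z ^ 4 + z ^ 5 + z ^ 9 - z ^ 2 - z ^ 6 - z ^ 7 - z ^ 8 - z ^ 10

/-- FIRST LEMMA (card balanced-undecic-pencil), pure algebra: if `ζ^11 = 𝟙` and the norm
`Σ_{k=0}^{10} ζ^k` vanishes (as on the Jacobian of a μ₁₁-cover of `ℙ¹`, whose quotient has trivial
Jacobian), then `φ := g(ζ)` satisfies the crux's hypothesis `φ ≫ φ = -(11 • 𝟙 A)`: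
`g² = (−1/11)(11 − Σₖ ζ^k) = −11`. -/
theorem gaussSum_sq (z : CategoryTheory.End A) (h11 : z ^ 11 = 1)
    (hnorm : (Finset.range 11).sum (fun k => z ^ k) = 0) :
    CategoryStruct.comp (gaussSum A z) (gaussSum A z) = -((11 : ℤ) • 𝟙 A) := by
  -- q = sum over the squares mod 11, n = sum over the non-squares
  set q : CategoryTheory.End A := z ^ 1 + z ^ 3 + z ^ 4 + z ^ 5 + z ^ 9 with hq
  set n : CategoryTheory.End A := z ^ 2 + z ^ 6 + z ^ 7 + z ^ 8 + z ^ 10 with hn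
  -- powers beyond 11 that occur in q * q
  have hred : ∀ m : ℕ, z ^ (11 + m) = z ^ m := fun m => by rw [pow_add, h11, one_mul]
  have h12 : z ^ 12 = z ^ 1 := hred 1
  have h13 : z ^ 13 = z ^ 2 := hred 2
  have h14 : z ^ 14 = z ^ 3 := hred 3
  have h18 : z ^ 18 = z ^ 7 := hred 7
  -- the norm relation: 1 + q + n = 0
  have hs : (Finset.range 11).sum (fun k => z ^ k) = 1 + q + n := by
    simp only [Finset.sum_range_succ, Finset.sum_range_zero, pow_zero, hq, hn]
    abel
  have hn' : n = -1 - q := by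
    have h := hnorm
    rw [hs] at h
    have : n = -(1 + q) := eq_neg_of_add_eq_zero_right h
    rw [this]; abel
  -- q² = 2q + 3n (count of a+b mod 11 over squares a, b)
  have hq2 : q * q = 2 • q + 3 • n := by
    simp only [hq, hn, mul_add, add_mul, ← pow_add, Nat.reduceAdd, h12, h13, h14, h18]
    simp only [two_smul, three_nsmul] -- unfold numerals? fallback below
    abel
  -- g = q - n = 2q + 1
  have hg : gaussSum A z = 2 • q + 1 := by
    have : gaussSum A z = q - n := by
      simp only [gaussSum, hq, hn, pow_one]
      abel
    rw [this, hn']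
    abel
  -- assemble
  have hmul : CategoryStruct.comp (gaussSum A z) (gaussSum A z) = gaussSum A z * gaussSum A z := rfl
  rw [hmul, hg]
  have hexp : (2 • q + 1) * (2 • q + 1) = 4 • (q * q) + 4 • q + 1 := by noncomm_ring
  rw [hexp, hq2, hn']
  change (4 • (2 • q + 3 • (-1 - q)) + 4 • q + 1 : CategoryTheory.End A) =
    -((11 : ℤ) • (1 : CategoryTheory.End A))
  module

/-- The crux restricted to tenfolds carrying an automorphism `ζ` of order 11 with vanishing norm,
for the endomorphism `φ = g(ζ)` (`φ ≫ φ = -11` by `gaussSum_sq`): this sub-case contains the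
balanced undecic pencil `J(y¹¹ = x⁴(x−1)⁹(x−a)¹⁰)` (card balanced-undecic-pencil) and every
`ℚ(ζ₁₁)`-anchor of card odd-norm-cm-enlargement.  It is the first TARGET of the pencil line. -/
def CyclotomicTenfoldCase : Prop :=
  ∀ (A : Motives.AbelianVariety ℂ) (ζ : A ⟶ A), A.dim = 10 →
    (show CategoryTheory.End A from ζ) ^ 11 = 1 →
    (Finset.range 11).sum (fun k => (show CategoryTheory.End A from ζ) ^ k) = 0 →
    ∀ c : complexBetti A.X 10, IsRationalClass c → IsOfHodgeType 10 A.X 10 5 5 c →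
      c ∈ weilPlane A (gaussSum A ζ) → c ∈ algebraicClasses A.X 5

/-- `CyclotomicTenfoldCase` is a literal special case of the crux (kernel-checked glue). -/
theorem cyclotomicTenfoldCase_of_crux (h : Crux) : CyclotomicTenfoldCase := by
  intro A ζ hdim h11 hnorm c hc hh hw
  exact h A (gaussSum A ζ) hdim (gaussSum_sq A ζ h11 hnorm) c hc hh hw

/-- FIRST LEMMA (card odd-norm-cm-enlargement): ON AN `L`-ANCHOR THE WEIL CLASSES ARE LEFSCHETZ.
Data: an abelian tenfold `A` with `ζ` of order 11 and vanishing norm (an action of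
`O_L = ℤ[ζ₁₁]`, `L = ℚ(ζ₁₁) ⊃ K = ℚ(√-11)`), `φ = g(ζ)`.  Hypothesis (the signature type
`(1,1)⁵`, stated in its Hodge-theoretic consequence): each cyclotomic divisor line `⋀² Vₖ`,
`k = 1, …, 10`, lies in the `ℂ`-span of the RATIONAL `(1,1)`-classes (true iff every `Vₖ` has Hodge
numbers `(1,1)`, because `⊕ₖ ⋀² Vₖ = (⋀²_L H¹) ⊗ ℂ` is a rational sub-Hodge structure whose ten
eigenlines form one Galois orbit).  Conclusion: the Weil classes of `(A, φ)` are algebraic.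
Proof on paper (Moonen–Zarhin norm relation `W_K = Nm_{L/K} ⋀²_L`): the `+`-Weil line is
`⋀¹⁰ V_σ = ⋀¹⁰(⊕_{k square} Vₖ) = ⋀²V₁ ∧ ⋀²V₃ ∧ ⋀²V₄ ∧ ⋀²V₅ ∧ ⋀²V₉`, a cup product of five classes
in `algebraicClasses A.X 1` (Lefschetz (1,1), tree fact `lefschetzOneOne_rational`), hence in
`algebraicClasses A.X 5` by the tree's PROVED `AbelianVariety.cupProduct_mem_algebraicClasses_one`
iterated four times; the gap to a Lean proof is `H¹⁰(A) = ⋀¹⁰ H¹` (not in tree, cf.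
`HodgeTheory/WeilClasses.lean`). -/
def LAnchorWeilLefschetz : Prop :=
  ∀ (A : Motives.AbelianVariety ℂ) (ζ : A ⟶ A), A.dim = 10 →
    (show CategoryTheory.End A from ζ) ^ 11 = 1 →
    (Finset.range 11).sum (fun k => (show CategoryTheory.End A from ζ) ^ k) = 0 →
    (∀ k : ℕ, 1 ≤ k → k ≤ 10 → cycloDivisorLine A ζ k ≤
        Submodule.span ℂ {b : complexBetti A.X 2 | IsRationalClass b ∧ IsOfHodgeType 10 A.X 2 1 1 b}) →
    ∀ c : complexBetti A.X 10, IsRationalClass c → IsOfHodgeType 10 A.X 10 5 5 c →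
      c ∈ weilPlane A (gaussSum A ζ) → c ∈ algebraicClasses A.X 5

/-- The anchor statement is a literal special case of the crux (so proving it is honest partial
progress, and the line's content is the TRANSPORT off the anchors). -/
theorem lAnchorWeilLefschetz_of_crux (h : Crux) : LAnchorWeilLefschetz := by
  intro A ζ hdim h11 hnorm _ c hc hh hw
  exact h A (gaussSum A ζ) hdim (gaussSum_sq A ζ h11 hnorm) c hc hh hw

/-- Converse bookkeeping: `LAnchorWeilLefschetz` also follows from `CyclotomicTenfoldCase`. -/
theorem lAnchorWeilLefschetz_of_cyclotomic (h : CyclotomicTenfoldCase) : LAnchorWeilLefschetz :=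
  fun A ζ hdim h11 hnorm _ c hc hh hw => h A ζ hdim h11 hnorm c hc hh hw

end Summit.HodgeConjecture.HodgeConjecture.Cruxes.WeilTenfoldsSqrtMinus11.IdeatorTwo

end
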